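import Summits.ABC.ABC.Theorems.IUTThetaPilotThetaPartIIULineCapstone
import HarnessLib

/-!
# The Σ-VARIANT CORE: [IUTchIII] Cor. 3.12 WITH A SLACK `ε` («−|log(q)| ≤ −|log(Θ)| + ε», the weakened Corollary an
# `S_H|Σ`-certificate delivers, `ε` = the off-Σ remainder) ⟹ [IUTchIV] Thm. 1.10's display UNCHANGED whenever
# `ε ≤ Tol(P,l) := ((l+1)/4)·5·d*_mod·l` ⟹ `abc` — the explicit error the chain of record tolerates (R-H round 2, Q2-cond)

PROOF-ONLY file (no `def`, no new `Prop`, no instance, no notation; nothing re-typed) of the abc-iut cell, R-H ROUND 2 seat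
abc-iut-rh2-q2-cond (rh-lead 2026-08-26T19:48:27Z: «Q2 — S|Σ ⇒ weakened Cor 3.12 ⇒ abc-with-worse-constant as kernel targets;
rh2-q2-cond: the Σ-variant of `abc_of_SH_v10K_window` with the constant loss = Q1's off-Σ error»). TAKES NO SIDE on [IUTchIII]
Cor. 3.12 or on any author. This file is the (P, l)-level and datum-level CORE of that certificate; the window certificate with
the v10K binder classes is its sequel `Conditional/AbcOfSHSigmaWindow.lean`.

S. Mochizuki, *Inter-universal Teichmüller theory IV*, RIMS manuscript (Apr. 2020; = PRIMS **57** (2021)), Thm. 1.10 (pp. 22–31: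
display `(1/6)·log(q) ≤ (1 + 20·d_mod/l)·(log(𝔡) + log(𝔣)) + 20·(d*_mod·l + η_prm)`, proof Steps (vii)–(viii) pp. 30–31, last
paragraph p. 31: "`(1 − 12/l²)⁻¹ ≤ 2`; `(1 − 12/l²)⁻¹·(1 + 12·d_mod/l) ≤ 1 + 20·d_mod/l`"), Prop. 1.6 (p. 16), Cor. 2.2 (ii)
(pp. 41–48) [claim: Mochizuki2012, status: disputed]; [IUTchIII] Cor. 3.12 (kurims p. 174: "`−|log(Θ)| ≥ −|log(q)|`").

WHAT IS TYPED (notation at an admissible `(P, l)`: `log(q) := Cor22.logQAvoid P {2,l}`, `L := log-diff + Cor22.logCondAvoid P {2,l}`,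
`d := d_mod`, `d* := 2^{12}·3^3·5·d`, `B_III(P,l) := (l+1)/4·{(1 + 12d/l)·L + 2·log l + 52 + (20/3)·log(d*·l)·π(d*·l)}` — the
constant of the registered cone binder `hreg` / `stub_hullRegime`, `((l+5)/4)·log π = ThetaVolumeInput.archLogTheta l`):
* §1 `input_gap_le_of_cor312Slack`, `gap_le_of_cor312Slack`, `logQAvoid_le_of_cor312Slack` — the SQUEEZE WITH SLACK: the weakened
  Corollary `−|log(q)| ≤ −|log(Θ)| + ε` at a genuine datum `T` and the hull estimate `T.HullEstimateOf δ` give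
  `((l+1)/24 − 1/(2l))·log(q) ≤ δ + ε + ((l+5)/4)·log π` (the slack simply joins `δ`; pure bookkeeping, cf. `Cor22.gap_le_at`);
* §2 **`display_of_squeezeIII_slack`** — Step (viii) at a point REDONE WITH A TOLERANCE: the squeeze with `B_III(P,l) + E`, `l ≥ 5` prime,
  `l ≠ 5`, `IsEtaPrm η` and **`E ≤ ((l+1)/4)·5·(d*·l + η)`** ⟹ `Cor22.Display P l η` WITH PRINT'S CONSTANTS UNCHANGED. The slack lives
  in print's own roundings: Prop. 1.6 gives `(20/3)·log(d*·l)·π(d*·l) ≤ (80/9)·(d*·l + η)`, Step (viii) absorbs `2·log l + 56 ≤ (4/9)·(…)`,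
  and the last paragraph needs only `c ≤ 20·(1 − 12/l²)` (`≥ 740/49` at `l ≥ 7`) for the coefficient `c` of `(d*·l + η)`; `84/9 + 5 =
  129/9 ≤ 740/49`. `display_of_squeezeIII_slack'`: the `η`-free tolerance `E ≤ ((l+1)/4)·5·d*·l` (good for EVERY `η_prm`);
* §3 `thm110Legendre_of_cor312Slack_of_hullRegime`, `ThetaPartII_of_cor312Slack_of_hullRegime`, **`ABC_of_cor312Slack_of_hullRegime`** —
  the Σ-variant of abc-iut-c312-8's `ThetaPartII.ABC_of_cor312_of_hullRegime`: hypotheses = a slack function `ε(P,l,T)` with the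
  WEAKENED number-level Corollary `T.negAbsLogQ ≤ T.negLogTheta + ε P l T` at every genuine datum of every admissible `(P,l)` [NUMΣ],
  the tolerance `ε P l T ≤ ((l+1)/4)·5·d*·l` [TOL], and the cone binder `hreg` VERBATIM [CONE] ⟹ `Cor22.Thm110Legendre` with print's
  constants ⟹ the crux `ThetaPartII` ⟹ `abc` (route deciding theorem `closes`, supports `genEllTwo_holds`, `JInvWlog_proof` PROVED).

READING, for rh-lead's Q1 («can the volume computation be re-run on Σ alone with the off-Σ contribution bounded by an explicit error abc
tolerates»), numbers not adjectives: in the currency of `−|log(Θ)|` / `B_III` (degree-normalised log-volumes, `log(q)` entering with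
coefficient `(l+1)/24 − 1/(2l)`), an off-Σ remainder `ε ≤ (5/4)·(l+1)·l·d*_mod = 691200·d_mod·l·(l+1)` is absorbed with NO change to any
constant of the chain of record (display, `H_unif = 2^140`, `C_K`); equivalently `≤ 1.66·10⁷·d_mod·l` in units of `log(q)`, i.e. about
`0.56×` the `(Ind1)`-prime-counting term `(l+1)/4·(20/3)·log(d*l)·π(d*l)` of `B_III` itself. A remainder growing like a FIXED fraction
`θ` of `((l+1)/24)·log(q)` is NOT absorbed by this file (in Cor. 2.2 (ii) `l ≥ log(q^∀)^{1/2}` is unbounded): it lowers `1/6` to `(1−θ)/6`,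
i.e. costs abc's EXPONENT, not its constant; a fraction `θ(l) ≤ c/l` is absorbed. A CONSTANT budget `K` beyond `Tol` costs only
`η_prm ↦ η_prm + K/5`, i.e. `C_K ↦ C_K + 8K` in (C2) — the «abc-with-worse-constant» twin, sequel file `AbcOfCor312SlackBudget.lean`.

HONEST FRAMING: this campaign LOCATES / CONDITIONALLY VERIFIES. Nothing here asserts that abc is proved or refuted, or that [IUTchIII]
Cor. 3.12 / Thm. 3.11 holds or fails at any datum (with or without slack), or takes a side on any author (Mochizuki / Scholze–Stix / Joshi /
Dupuy–Hilado); the weakened Corollary is an ASSUMPTION LABEL; «`ABC` follows from these hypotheses AS TYPED», nothing more; typed ≠ proved;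
instantiated ≠ endorsed. [cite: Mochizuki2012, IUTchIV Thm. 1.10 pp. 22–31, Steps (vii)–(viii) pp. 30–31; Prop. 1.6 p. 16; Cor. 2.2 (ii) pp. 41–48]
[cite: Mochizuki2012, IUTchIII Cor. 3.12 p. 174] [claim: Mochizuki2012, status: disputed]
-/

noncomputable section

namespace Summit.ABC.IUTFork.Conditional.Cor312Slack

open Literature.IUT.LogVolume Literature.IUT.HodgeTheaters Literature.NumberTheory.DiophantineGeometry.GenEll
open Summit.ABC.ABC.Theorems NumberField IsDedekindDomain

/-! ## §1 The squeeze with slack -/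

/-- **The squeeze with slack, input level**: `−|log(q)| ≤ −|log(Θ)| + ε` and the hull estimate with `δ` give
`deĝ̲_lgp(P_Θ) − deĝ̲(P_q) ≤ δ + ε + ((l+5)/4)·log π`. Pure arithmetic of the two inequalities (the slack joins `δ`); no side taken.
[cite: Mochizuki2012, IUTchIV Thm. 1.10 Steps (vii)–(viii) p. 30–31] [claim: Mochizuki2012, status: disputed] -/
theorem input_gap_le_of_cor312Slack {F₀ : Type} [Field F₀] [NumberField F₀] {K : Type} [Field K] [NumberField K] [Algebra F₀ K]
    (I : ThetaVolumeInput F₀ K) {δ ε : ℝ} (h1 : I.negAbsLogQ ≤ I.negLogTheta + ε) (h2 : I.HullEstimateOf δ) :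
    LgpDivisor.ndegLgp I.X.thetaPilot - FinDivisor.ndeg F₀ I.X.qPilot ≤ δ + ε + ThetaVolumeInput.archLogTheta I.l := by
  unfold ThetaVolumeInput.negLogTheta ThetaVolumeInput.negAbsLogQ at h1
  unfold ThetaVolumeInput.HullEstimateOf at h2
  linarith

variable {P : NFPoint} {l : ℕ}

/-- **The squeeze with slack at a genuine datum `T` of `(P, l)`**: `T.negAbsLogQ ≤ T.negLogTheta + ε` (the WEAKENED Corollary,
hypothesis) and `T.HullEstimateOf δ` give `T.gap ≤ δ + ε + ((l+5)/4)·log π` (cf. `Cor22.ThetaVolumeDatumAt.gap_le` at `ε = 0`).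
[cite: Mochizuki2012, IUTchIV Thm. 1.10 Steps (viii)–(x) p. 30–32] [claim: Mochizuki2012, status: disputed] -/
theorem gap_le_of_cor312Slack (T : Cor22.ThetaVolumeDatumAt P l) {δ ε : ℝ} (h1 : T.negAbsLogQ ≤ T.negLogTheta + ε)
    (h2 : T.HullEstimateOf δ) : T.gap ≤ δ + ε + ThetaVolumeInput.archLogTheta l := by
  letI := T.instFieldF; letI := T.instNumberFieldF; letI := T.instFieldK; letI := T.instNumberFieldK
  letI := T.instAlgebraK
  have h := input_gap_le_of_cor312Slack T.I h1 h2
  rw [T.l_eq] at h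
  exact h

/-- **The squeeze with slack IN PRINT'S CURRENCY**: at a genuine datum `T` of `(P, l)` with `λ ∈ U_X`, the weakened Corollary with slack
`ε` and the hull estimate with `δ` give `((l+1)/24 − 1/(2l))·log(q^{∤{2,l}}(λ)) ≤ δ + ε + ((l+5)/4)·log π` (abc-iut-S2's
`PointDict.gap_eq`). [cite: Mochizuki2012, IUTchIV Thm. 1.10 Step (viii) p. 30] [claim: Mochizuki2012, status: disputed] -/
theorem logQAvoid_le_of_cor312Slack (T : Cor22.ThetaVolumeDatumAt P l) (hU : P.InU) {δ ε : ℝ}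
    (h1 : T.negAbsLogQ ≤ T.negLogTheta + ε) (h2 : T.HullEstimateOf δ) :
    (((l : ℝ) + 1) / 24 - 1 / (2 * l)) * Cor22.logQAvoid P {2, l} ≤ δ + ε + ThetaVolumeInput.archLogTheta l := by
  rw [← PointDict.gap_eq T hU]
  exact gap_le_of_cor312Slack T h1 h2

/-! ## §2 Step (viii) at a point with a TOLERANCE: the display survives `E ≤ ((l+1)/4)·5·(d*·l + η_prm)` -/

/-- `l` prime, `l ≥ 5`, `l ≠ 5` ⟹ `l ≥ 7` ([IUTchIV] Thm. 1.10 p. 22: "`l ≥ 5` … `l ≠ 5`", so `l ≥ 7`). [folklore] -/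
theorem seven_le_of_prime_of_ne_five {l : ℕ} (hl : l.Prime) (h5 : 5 ≤ l) (hne : l ≠ 5) : 7 ≤ l := by
  rcases Nat.lt_or_ge l 7 with h | h
  · exfalso
    interval_cases l
    · exact hne rfl
    · exact absurd hl (by norm_num)
  · exact h

/-- **The last paragraph of the proof of [IUTchIV] Thm. 1.10 (p. 31) WITH THE TOLERANCE, as real arithmetic**: for `l ≥ 7`, `d ≥ 1`,
`L ≥ 0`, `Q > 0`, `E₁ > 0`, `(1/6)(1 − 12/l²)·Q ≤ (1 + 12d/l)·L + (129/9)·E₁` implies `(1/6)·Q ≤ (1 + 20d/l)·L + 20·E₁` — print's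
"`(1 − 12/l²)⁻¹·(1 + 12·d_mod/l) ≤ 1 + 20·d_mod/l`" together with `129/9 ≤ 20·(1 − 12/l²)` (`= 740/49` at `l = 7`), the room the slack uses.
[cite: Mochizuki2012, IUTchIV Thm. 1.10 proof, last paragraph p. 31] [claim: Mochizuki2012, status: disputed] -/
theorem display_arith {l d L Q E₁ : ℝ} (hl7 : 7 ≤ l) (hd1 : 1 ≤ d) (hL : 0 ≤ L) (hQ : 0 < Q) (hE₁ : 0 < E₁)
    (h : 1 / 6 * (1 - 12 / l ^ 2) * Q ≤ (1 + 12 * d / l) * L + 129 / 9 * E₁) :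
    1 / 6 * Q ≤ (1 + 20 * d / l) * L + 20 * E₁ := by
  have hl0 : 0 < l := by linarith
  have _hQ := hQ
  set t : ℝ := 1 / l with ht
  have ht0 : 0 < t := by rw [ht]; positivity
  have ht7 : t ≤ 1 / 7 := by rw [ht]; exact one_div_le_one_div_of_le (by norm_num) hl7
  have e1 : 12 * d / l = 12 * d * t := by rw [ht]; ring
  have e2 : 12 / l ^ 2 = 12 * t ^ 2 := by rw [ht]; field_simp
  have e3 : 20 * d / l = 20 * d * t := by rw [ht]; ring
  rw [e1, e2] at h
  rw [e3]
  have ht2 : t ^ 2 ≤ 1 / 49 := by nlinarith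
  have hden : 0 < 1 - 12 * t ^ 2 := by linarith
  have hstep : 1 / 6 * Q * (1 - 12 * t ^ 2) ≤ (1 + 12 * d * t) * L + 129 / 9 * E₁ := by linarith
  have hc1 : (1 + 12 * d * t) ≤ (1 + 20 * d * t) * (1 - 12 * t ^ 2) := by
    have hA : 240 * d * t ^ 2 ≤ 240 * d * (1 / 49) := mul_le_mul_of_nonneg_left ht2 (by positivity)
    have hpos : 0 ≤ 8 * d - 12 * t - 240 * d * t ^ 2 := by linarith
    have hprod := mul_nonneg (le_of_lt ht0) hpos
    have expand : (1 + 20 * d * t) * (1 - 12 * t ^ 2) - (1 + 12 * d * t) = t * (8 * d - 12 * t - 240 * d * t ^ 2) := by ring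
    linarith
  have hc2 : (129 / 9 : ℝ) ≤ 20 * (1 - 12 * t ^ 2) := by linarith
  have key : (1 + 12 * d * t) * L + 129 / 9 * E₁ ≤ ((1 + 20 * d * t) * L + 20 * E₁) * (1 - 12 * t ^ 2) := by
    have a1 := mul_le_mul_of_nonneg_right hc1 hL
    have a2 := mul_le_mul_of_nonneg_right hc2 hE₁.le
    have expand : ((1 + 20 * d * t) * L + 20 * E₁) * (1 - 12 * t ^ 2) =
        (1 + 20 * d * t) * (1 - 12 * t ^ 2) * L + 20 * (1 - 12 * t ^ 2) * E₁ := by ring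
    rw [expand]
    linarith
  exact le_of_mul_le_mul_right (le_trans hstep key) hden

/-- **[IUTchIV] Thm. 1.10 Step (viii) at a point of the `λ`-line, constant `B_III`, WITH A TOLERANCE `E`** (pp. 30–31 and the last
paragraph of the proof, p. 31, redone without `ProofData`): the squeeze with `B_III(P,l) + E`, `l ≥ 5` prime, `l ≠ 5`, `IsEtaPrm η_prm`
and `E ≤ ((l+1)/4)·5·(d*·l + η_prm)` imply print's display `Cor22.Display P l η_prm` UNCHANGED. The arithmetic: Step (vii)
`(l+5)/4·log π ≤ (l+1)/4·4`; `(l+1)/4·(1/6)·(1 − 12/l²) ≤ (l+1)/24 − 1/(2l)`; Prop. 1.6 `log(d*·l)·π(d*·l) ≤ (4/3)·(d*·l + η_prm)`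
(`log_mul_primeCounting_le_of_isEtaPrm`, PROVED); `2·log l + 56 ≤ (4/9)·d*·l`; whence `(1/6)(1 − 12/l²)·log(q) ≤ (1 + 12d/l)·L +
(129/9)·(d*·l + η_prm)`, and `display_arith`. Pure arithmetic; no side taken.
[cite: Mochizuki2012, IUTchIV Thm. 1.10 Steps (vii)–(viii) p. 30–31] [claim: Mochizuki2012, status: disputed] -/
theorem display_of_squeezeIII_slack (hl : l.Prime) (h5 : 5 ≤ l) (hne : l ≠ 5) {η : ℝ} (hη : IsEtaPrm η) {E : ℝ}
    (hE : E ≤ ((l : ℝ) + 1) / 4 * (5 * ((((2 ^ 12 * 3 ^ 3 * 5 * Cor22.dmod P : ℕ) : ℝ)) * l + η)))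
    (hineq : (((l : ℝ) + 1) / 24 - 1 / (2 * l)) * Cor22.logQAvoid P {2, l} ≤
      ((l : ℝ) + 1) / 4 *
          ((1 + 12 * (Cor22.dmod P : ℝ) / l) * (P.logDiff + Cor22.logCondAvoid P {2, l})
            + 2 * Real.log l + 52
            + 20 / 3 * Real.log (((2 ^ 12 * 3 ^ 3 * 5 * Cor22.dmod P : ℕ) : ℝ) * (l : ℝ))
              * (Nat.primeCounting (2 ^ 12 * 3 ^ 3 * 5 * Cor22.dmod P * l) : ℝ))
        + E + ThetaVolumeInput.archLogTheta l) :
    Cor22.Display P l η := by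
  have hLD : 0 ≤ P.logDiff := P.logDiff_nonneg
  have hLC : 0 ≤ Cor22.logCondAvoid P {2, l} := Cor22.logCondAvoid_nonneg P {2, l}
  have h7 : 7 ≤ l := seven_le_of_prime_of_ne_five hl h5 hne
  have hl7 : (7 : ℝ) ≤ l := by exact_mod_cast h7
  have hl0 : (0 : ℝ) < l := by linarith
  have hd1 : (1 : ℝ) ≤ (Cor22.dmod P : ℝ) := by exact_mod_cast Cor22.dmod_pos P
  have hη0 : 0 < η := hη.1
  have hDst : (((2 ^ 12 * 3 ^ 3 * 5 * Cor22.dmod P : ℕ) : ℝ)) = 552960 * (Cor22.dmod P : ℝ) := by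
    push_cast; ring
  have hDst0 : (0 : ℝ) < (((2 ^ 12 * 3 ^ 3 * 5 * Cor22.dmod P : ℕ) : ℝ)) := by rw [hDst]; positivity
  have hE₁0 : 0 < (((2 ^ 12 * 3 ^ 3 * 5 * Cor22.dmod P : ℕ) : ℝ)) * l + η := by positivity
  by_cases hq : 0 < Cor22.logQAvoid P {2, l}
  swap
  · -- `log(q) ≤ 0`: the display is trivial (its right-hand side is nonnegative)
    have hq' : Cor22.logQAvoid P {2, l} ≤ 0 := not_lt.1 hq
    unfold Cor22.Display
    have h1 : 0 ≤ (1 + 20 * (Cor22.dmod P : ℝ) / l) * (P.logDiff + Cor22.logCondAvoid P {2, l}) := by positivity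
    have h2 : 0 ≤ 20 * (2 ^ 12 * 3 ^ 3 * 5 * (Cor22.dmod P : ℝ) * l + η) := by positivity
    linarith
  -- Prop. 1.6 (proved in the tree): `log(d*·l)·π(d*·l) ≤ (4/3)·(d*·l + η)`
  have hpnt : Real.log ((((2 ^ 12 * 3 ^ 3 * 5 * Cor22.dmod P : ℕ) : ℝ)) * (l : ℝ))
      * (Nat.primeCounting (2 ^ 12 * 3 ^ 3 * 5 * Cor22.dmod P * l) : ℝ) ≤
      4 / 3 * ((((2 ^ 12 * 3 ^ 3 * 5 * Cor22.dmod P : ℕ) : ℝ)) * l + η) := by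
    have h0 : (0 : ℝ) ≤ (((2 ^ 12 * 3 ^ 3 * 5 * Cor22.dmod P : ℕ) : ℝ)) * l := by positivity
    have h2 := log_mul_primeCounting_le_of_isEtaPrm hη h0
    rwa [show ⌊(((2 ^ 12 * 3 ^ 3 * 5 * Cor22.dmod P : ℕ) : ℝ)) * (l : ℝ)⌋₊ = 2 ^ 12 * 3 ^ 3 * 5 * Cor22.dmod P * l by
      exact_mod_cast Nat.floor_natCast (2 ^ 12 * 3 ^ 3 * 5 * Cor22.dmod P * l)] at h2
  -- from here on the constant `d* = 2^12·3^3·5·d_mod` (as a real number) is an opaque atom `N = 552960·d_mod`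
  generalize hN : (((2 ^ 12 * 3 ^ 3 * 5 * Cor22.dmod P : ℕ) : ℝ)) = N at hE hineq hpnt hDst hDst0 hE₁0 ⊢
  -- Step (viii)'s absorption `2·log l + 56 ≤ (4/9)·d*·l ≤ (4/9)·(d*·l + η)` (`log l ≤ l − 1`, `d* ≥ 552960`)
  have habs : 2 * Real.log (l : ℝ) + 56 ≤ 4 / 9 * (N * l + η) := by
    have hlogl : Real.log (l : ℝ) ≤ (l : ℝ) - 1 := Real.log_le_sub_one_of_pos hl0
    have hprod : (552960 : ℝ) * l ≤ N * l := by
      rw [hDst]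
      exact mul_le_mul_of_nonneg_right (by nlinarith) hl0.le
    linarith
  -- Step (vii): `(l+5)/4·log π ≤ (l+1)/4·4`
  have harch : ThetaVolumeInput.archLogTheta l ≤ ((l : ℝ) + 1) / 4 * 4 := by
    unfold ThetaVolumeInput.archLogTheta
    have hpi := log_pi_le_two
    have h1 : ((l : ℝ) + 5) / 4 * Real.log Real.pi ≤ ((l : ℝ) + 5) / 4 * 2 :=
      mul_le_mul_of_nonneg_left hpi (by positivity)
    linarith
  -- the prime-counting atom
  set W : ℝ := 20 / 3 * Real.log (N * (l : ℝ)) * (Nat.primeCounting (2 ^ 12 * 3 ^ 3 * 5 * Cor22.dmod P * l) : ℝ) with hW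
  have hW' : W ≤ 20 / 3 * (4 / 3 * (N * l + η)) := by
    rw [hW, mul_assoc]
    exact mul_le_mul_of_nonneg_left hpnt (by norm_num)
  have hc : (0 : ℝ) < ((l : ℝ) + 1) / 4 := by positivity
  -- hypothesis + tolerance + Step (vii): everything to the right of `(l+1)/4·`
  have h1 : (((l : ℝ) + 1) / 24 - 1 / (2 * l)) * Cor22.logQAvoid P {2, l} ≤
      ((l : ℝ) + 1) / 4 * ((1 + 12 * (Cor22.dmod P : ℝ) / l) * (P.logDiff + Cor22.logCondAvoid P {2, l})
        + 2 * Real.log l + 52 + W + 5 * (N * l + η) + 4) := by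
    have e : ((l : ℝ) + 1) / 4 * ((1 + 12 * (Cor22.dmod P : ℝ) / l) * (P.logDiff + Cor22.logCondAvoid P {2, l})
        + 2 * Real.log l + 52 + W + 5 * (N * l + η) + 4) =
        ((l : ℝ) + 1) / 4 * ((1 + 12 * (Cor22.dmod P : ℝ) / l) * (P.logDiff + Cor22.logCondAvoid P {2, l})
          + 2 * Real.log l + 52 + W)
          + ((l : ℝ) + 1) / 4 * (5 * (N * l + η)) + ((l : ℝ) + 1) / 4 * 4 := by
      ring
    rw [e]
    linarith
  -- `(l+1)/4·(1/6)·(1 − 12/l²) ≤ (l+1)/24 − 1/(2l)`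
  have hcoef : ((l : ℝ) + 1) / 4 * (1 / 6 * (1 - 12 / (l : ℝ) ^ 2)) ≤ ((l : ℝ) + 1) / 24 - 1 / (2 * l) := by
    have hdiff : ((l : ℝ) + 1) / 24 - 1 / (2 * l) - ((l : ℝ) + 1) / 4 * (1 / 6 * (1 - 12 / (l : ℝ) ^ 2))
        = 1 / (2 * (l : ℝ) ^ 2) := by
      field_simp
      ring
    have hpos : (0 : ℝ) ≤ 1 / (2 * (l : ℝ) ^ 2) := by positivity
    linarith
  have h2 : ((l : ℝ) + 1) / 4 * (1 / 6 * (1 - 12 / (l : ℝ) ^ 2) * Cor22.logQAvoid P {2, l}) ≤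
      (((l : ℝ) + 1) / 24 - 1 / (2 * l)) * Cor22.logQAvoid P {2, l} := by
    calc ((l : ℝ) + 1) / 4 * (1 / 6 * (1 - 12 / (l : ℝ) ^ 2) * Cor22.logQAvoid P {2, l})
        = ((l : ℝ) + 1) / 4 * (1 / 6 * (1 - 12 / (l : ℝ) ^ 2)) * Cor22.logQAvoid P {2, l} := by ring
      _ ≤ (((l : ℝ) + 1) / 24 - 1 / (2 * l)) * Cor22.logQAvoid P {2, l} := mul_le_mul_of_nonneg_right hcoef hq.le
  have h3 : 1 / 6 * (1 - 12 / (l : ℝ) ^ 2) * Cor22.logQAvoid P {2, l} ≤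
      (1 + 12 * (Cor22.dmod P : ℝ) / l) * (P.logDiff + Cor22.logCondAvoid P {2, l})
        + 2 * Real.log l + 52 + W + 5 * (N * l + η) + 4 :=
    le_of_mul_le_mul_left (le_trans h2 h1) hc
  -- collect: `(1/6)(1 − 12/l²)·log(q) ≤ (1 + 12d/l)·L + (129/9)·(d*·l + η)`, then the last paragraph
  have h4 : 1 / 6 * (1 - 12 / (l : ℝ) ^ 2) * Cor22.logQAvoid P {2, l} ≤
      (1 + 12 * (Cor22.dmod P : ℝ) / l) * (P.logDiff + Cor22.logCondAvoid P {2, l}) + 129 / 9 * (N * l + η) := by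
    linarith [hW', habs, h3]
  have h5' := display_arith hl7 hd1 (add_nonneg hLD hLC) hq hE₁0 h4
  unfold Cor22.Display
  have e4 : 2 ^ 12 * 3 ^ 3 * 5 * (Cor22.dmod P : ℝ) * l + η = N * l + η := by
    rw [hDst]; ring
  rw [e4]
  exact h5'

/-- **The `η`-free tolerance** (valid for EVERY `η_prm` of Prop. 1.6, hence inside `Cor22.Thm110Legendre`): the squeeze with
`B_III(P,l) + E` and `E ≤ ((l+1)/4)·5·d*·l` imply `Cor22.Display P l η_prm`. [cite: Mochizuki2012, IUTchIV Thm. 1.10 Step (viii) p. 30–31]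
[claim: Mochizuki2012, status: disputed] -/
theorem display_of_squeezeIII_slack' (hl : l.Prime) (h5 : 5 ≤ l) (hne : l ≠ 5) {η : ℝ} (hη : IsEtaPrm η) {E : ℝ}
    (hE : E ≤ ((l : ℝ) + 1) / 4 * (5 * ((((2 ^ 12 * 3 ^ 3 * 5 * Cor22.dmod P : ℕ) : ℝ)) * l)))
    (hineq : (((l : ℝ) + 1) / 24 - 1 / (2 * l)) * Cor22.logQAvoid P {2, l} ≤
      ((l : ℝ) + 1) / 4 *
          ((1 + 12 * (Cor22.dmod P : ℝ) / l) * (P.logDiff + Cor22.logCondAvoid P {2, l})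
            + 2 * Real.log l + 52
            + 20 / 3 * Real.log (((2 ^ 12 * 3 ^ 3 * 5 * Cor22.dmod P : ℕ) : ℝ) * (l : ℝ))
              * (Nat.primeCounting (2 ^ 12 * 3 ^ 3 * 5 * Cor22.dmod P * l) : ℝ))
        + E + ThetaVolumeInput.archLogTheta l) :
    Cor22.Display P l η := by
  refine display_of_squeezeIII_slack hl h5 hne hη (le_trans hE ?_) hineq
  have hη0 : 0 < η := hη.1
  have hc : (0 : ℝ) ≤ ((l : ℝ) + 1) / 4 := by positivity
  exact mul_le_mul_of_nonneg_left (by nlinarith) hc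

/-! ## §3 `Thm110Legendre`, the crux `ThetaPartII` and `ABC` from the WEAKENED Corollary with a tolerated slack and the cone binder -/

/-- **`Cor22.Thm110Legendre` (print's constants) from the weakened Corollary with slack `ε ≤ ((l+1)/4)·5·d*·l` and the cone binder
`hreg`** (the Σ-variant of abc-iut-c312-8's `ThetaPartII.ThetaPartII_of_cor312_of_hullRegime`, first half): at each admissible `(P, l)` a
genuine datum exists (abc-iut-L5-t7 `ThetaPartII.stub_thetaData`), the hull estimate with `B_III` holds at it (`ThetaPartII.hullVolume_of_hullRegime`:
abc-iut-S1's (R4), abc-iut-S3's pinned junction, `hreg` off the regime), and §1–§2 turn the weakened Corollary into the display; `l ≠ 5` by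
`ThetaPartIIDisplay.thm110Legendre_of_pointwise`. CONDITIONAL on `h312ε`, `hTol`, `hreg`; no side taken.
[cite: Mochizuki2012, IUTchIV Thm. 1.10 pp. 22–31; Cor. 2.2 (ii) proof p. 46] [claim: Mochizuki2012, status: disputed] -/
theorem thm110Legendre_of_cor312Slack_of_hullRegime
    (ε : ∀ (P : NFPoint) (l : ℕ), Cor22.ThetaVolumeDatumAt P l → ℝ)
    (h312ε : ∀ P : NFPoint, P ∈ UP → ∀ l : ℕ, l.Prime → 5 ≤ l →
      Cor22.AdmitsCore P → Cor22.CondP2 P l → Cor22.CondP5 P l → Cor22.CondP6 P l →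
      ∀ T : Cor22.ThetaVolumeDatumAt P l, T.negAbsLogQ ≤ T.negLogTheta + ε P l T)
    (hTol : ∀ P : NFPoint, P ∈ UP → ∀ l : ℕ, l.Prime → 5 ≤ l →
      Cor22.AdmitsCore P → Cor22.CondP2 P l → Cor22.CondP5 P l → Cor22.CondP6 P l →
      ∀ T : Cor22.ThetaVolumeDatumAt P l, ε P l T ≤ ((l : ℝ) + 1) / 4 * (5 * ((((2 ^ 12 * 3 ^ 3 * 5 * Cor22.dmod P : ℕ) : ℝ)) * l)))
    (hreg : ∀ P : NFPoint, P ∈ UP → ∀ l : ℕ, l.Prime → 5 ≤ l →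
      Cor22.AdmitsCore P → Cor22.CondP2 P l → Cor22.CondP5 P l → Cor22.CondP6 P l →
      ∀ T : Cor22.ThetaVolumeDatumAt P l,
        (letI := T.instFieldF; letI := T.instNumberFieldF; letI := T.instAlgebraF; letI := T.instFieldK
         letI := T.instNumberFieldK; letI := T.instAlgebraK; letI := T.instFieldFbar; letI := T.instAlgebraFbar
         letI := T.instAlgebraKFbar; letI := T.instIsElliptic
         ¬ (∀ p ∈ T.I.supportPrimes, ∀ v w : placesOver (fieldOfModuli T.E) p,
            (Summit.ABC.IUTFork.DHData.ofInput T.I).logQloc p v = (Summit.ABC.IUTFork.DHData.ofInput T.I).logQloc p w)) →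
        T.HullEstimateOf
          (((l : ℝ) + 1) / 4 *
            ((1 + 12 * (Cor22.dmod P : ℝ) / l) * (P.logDiff + Cor22.logCondAvoid P {2, l})
              + 2 * Real.log l + 52
              + 20 / 3 * Real.log (((2 ^ 12 * 3 ^ 3 * 5 * Cor22.dmod P : ℕ) : ℝ) * (l : ℝ))
                * (Nat.primeCounting (2 ^ 12 * 3 ^ 3 * 5 * Cor22.dmod P * l) : ℝ)))) :
    Cor22.Thm110Legendre :=
  ThetaPartIIDisplay.thm110Legendre_of_pointwise fun η hη P hP l hl h5 hne hcore hP2 hP5 h6 => by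
    obtain ⟨T⟩ := ThetaPartII.stub_thetaData P hP l hl h5 hcore hP2 hP5 h6
    have hU : P.InU := hP.1
    have hgap := logQAvoid_le_of_cor312Slack T hU (h312ε P hP l hl h5 hcore hP2 hP5 h6 T)
      (ThetaPartII.hullVolume_of_hullRegime hreg P hP l hl h5 hcore hP2 hP5 h6 T)
    exact display_of_squeezeIII_slack' hl h5 hne hη (hTol P hP l hl h5 hcore hP2 hP5 h6 T) hgap

/-- **The crux `ThetaPartII` from the weakened Corollary with a tolerated slack and the cone binder** (abc-iut-S3's
`Cor22.exists_partII_of_thm110Legendre` + the proved `Cor22.fullGaloisImage_holds`). CONDITIONAL; does not close any item; no side taken.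
[cite: Mochizuki2012, IUTchIV Cor. 2.2 (ii) pp. 41–48] [claim: Mochizuki2012, status: disputed] -/
theorem ThetaPartII_of_cor312Slack_of_hullRegime
    (ε : ∀ (P : NFPoint) (l : ℕ), Cor22.ThetaVolumeDatumAt P l → ℝ)
    (h312ε : ∀ P : NFPoint, P ∈ UP → ∀ l : ℕ, l.Prime → 5 ≤ l →
      Cor22.AdmitsCore P → Cor22.CondP2 P l → Cor22.CondP5 P l → Cor22.CondP6 P l →
      ∀ T : Cor22.ThetaVolumeDatumAt P l, T.negAbsLogQ ≤ T.negLogTheta + ε P l T)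
    (hTol : ∀ P : NFPoint, P ∈ UP → ∀ l : ℕ, l.Prime → 5 ≤ l →
      Cor22.AdmitsCore P → Cor22.CondP2 P l → Cor22.CondP5 P l → Cor22.CondP6 P l →
      ∀ T : Cor22.ThetaVolumeDatumAt P l, ε P l T ≤ ((l : ℝ) + 1) / 4 * (5 * ((((2 ^ 12 * 3 ^ 3 * 5 * Cor22.dmod P : ℕ) : ℝ)) * l)))
    (hreg : ∀ P : NFPoint, P ∈ UP → ∀ l : ℕ, l.Prime → 5 ≤ l →
      Cor22.AdmitsCore P → Cor22.CondP2 P l → Cor22.CondP5 P l → Cor22.CondP6 P l →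
      ∀ T : Cor22.ThetaVolumeDatumAt P l,
        (letI := T.instFieldF; letI := T.instNumberFieldF; letI := T.instAlgebraF; letI := T.instFieldK
         letI := T.instNumberFieldK; letI := T.instAlgebraK; letI := T.instFieldFbar; letI := T.instAlgebraFbar
         letI := T.instAlgebraKFbar; letI := T.instIsElliptic
         ¬ (∀ p ∈ T.I.supportPrimes, ∀ v w : placesOver (fieldOfModuli T.E) p,
            (Summit.ABC.IUTFork.DHData.ofInput T.I).logQloc p v = (Summit.ABC.IUTFork.DHData.ofInput T.I).logQloc p w)) →
        T.HullEstimateOf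
          (((l : ℝ) + 1) / 4 *
            ((1 + 12 * (Cor22.dmod P : ℝ) / l) * (P.logDiff + Cor22.logCondAvoid P {2, l})
              + 2 * Real.log l + 52
              + 20 / 3 * Real.log (((2 ^ 12 * 3 ^ 3 * 5 * Cor22.dmod P : ℕ) : ℝ) * (l : ℝ))
                * (Nat.primeCounting (2 ^ 12 * 3 ^ 3 * 5 * Cor22.dmod P * l) : ℝ)))) :
    Summit.ABC.ABC.Theses.IUTThetaPilot.ThetaPartII := by
  unfold Summit.ABC.ABC.Theses.IUTThetaPilot.ThetaPartII
  exact Cor22.exists_partII_of_thm110Legendre (thm110Legendre_of_cor312Slack_of_hullRegime ε h312ε hTol hreg)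
    Cor22.fullGaloisImage_holds

/-- **`abc` FROM THE WEAKENED COROLLARY WITH A TOLERATED SLACK AND THE CONE BINDER** — the Σ-variant of abc-iut-c312-8's
`ThetaPartII.ABC_of_cor312_of_hullRegime`: [NUMΣ] `−|log(q)| ≤ −|log(Θ)| + ε(P,l,T)` at every genuine Θ-volume datum of every admissible
`(P, l)` (the weakened Corollary an `S_H|Σ`-certificate delivers, `ε` = the off-Σ remainder; ASSUMPTION LABEL), [TOL] `ε(P,l,T) ≤
((l+1)/4)·5·d*_mod·l`, [CONE] `hreg` verbatim ⟹ `ABC`, with NO constant of the chain of record changed (route deciding theorem `closes`;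
supports `genEllTwo_holds`, `JInvWlog_proof` PROVED). CONDITIONAL; nothing is asserted about the hypotheses; no side taken.
[cite: Mochizuki2012, IUTchIV Cor. 2.2–2.3 pp. 41–55] [cite: Mochizuki2012, IUTchIII Cor. 3.12 p. 174] [claim: Mochizuki2012, status: disputed] -/
theorem ABC_of_cor312Slack_of_hullRegime
    (ε : ∀ (P : NFPoint) (l : ℕ), Cor22.ThetaVolumeDatumAt P l → ℝ)
    (h312ε : ∀ P : NFPoint, P ∈ UP → ∀ l : ℕ, l.Prime → 5 ≤ l →
      Cor22.AdmitsCore P → Cor22.CondP2 P l → Cor22.CondP5 P l → Cor22.CondP6 P l →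
      ∀ T : Cor22.ThetaVolumeDatumAt P l, T.negAbsLogQ ≤ T.negLogTheta + ε P l T)
    (hTol : ∀ P : NFPoint, P ∈ UP → ∀ l : ℕ, l.Prime → 5 ≤ l →
      Cor22.AdmitsCore P → Cor22.CondP2 P l → Cor22.CondP5 P l → Cor22.CondP6 P l →
      ∀ T : Cor22.ThetaVolumeDatumAt P l, ε P l T ≤ ((l : ℝ) + 1) / 4 * (5 * ((((2 ^ 12 * 3 ^ 3 * 5 * Cor22.dmod P : ℕ) : ℝ)) * l)))
    (hreg : ∀ P : NFPoint, P ∈ UP → ∀ l : ℕ, l.Prime → 5 ≤ l →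
      Cor22.AdmitsCore P → Cor22.CondP2 P l → Cor22.CondP5 P l → Cor22.CondP6 P l →
      ∀ T : Cor22.ThetaVolumeDatumAt P l,
        (letI := T.instFieldF; letI := T.instNumberFieldF; letI := T.instAlgebraF; letI := T.instFieldK
         letI := T.instNumberFieldK; letI := T.instAlgebraK; letI := T.instFieldFbar; letI := T.instAlgebraFbar
         letI := T.instAlgebraKFbar; letI := T.instIsElliptic
         ¬ (∀ p ∈ T.I.supportPrimes, ∀ v w : placesOver (fieldOfModuli T.E) p,
            (Summit.ABC.IUTFork.DHData.ofInput T.I).logQloc p v = (Summit.ABC.IUTFork.DHData.ofInput T.I).logQloc p w)) →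
        T.HullEstimateOf
          (((l : ℝ) + 1) / 4 *
            ((1 + 12 * (Cor22.dmod P : ℝ) / l) * (P.logDiff + Cor22.logCondAvoid P {2, l})
              + 2 * Real.log l + 52
              + 20 / 3 * Real.log (((2 ^ 12 * 3 ^ 3 * 5 * Cor22.dmod P : ℕ) : ℝ) * (l : ℝ))
                * (Nat.primeCounting (2 ^ 12 * 3 ^ 3 * 5 * Cor22.dmod P * l) : ℝ)))) :
    _root_.ABC :=
  Summit.ABC.ABC.Theses.IUTThetaPilot.closes (ThetaPartII_of_cor312Slack_of_hullRegime ε h312ε hTol hreg)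
    Summit.ABC.ABC.Theorems.genEllTwo_holds Summit.ABC.ABC.Theorems.JInvWlog_proof

end Summit.ABC.IUTFork.Conditional.Cor312Slack

end
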